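import Summits.ResolutionOfSingularities.ResolutionOfSingularities.Theorems.FrobeniusLadderFRationalResolutionBlowupCartierBaseChangeLocal
import Literature.AlgebraicGeometry.Resolution.AdicNoetherian
import Mathlib.RingTheory.AdicCompletion.AsTensorProduct
import Mathlib.RingTheory.AdicCompletion.LocalRing
import Mathlib.RingTheory.Flat.FaithfullyFlat.Algebra
import HarnessLib

/-!
# Crux `FrobeniusLadder.FRationalResolution` (stmt-ResolutionOfSingularities-15317), line `redirect`,
# stub `stub_diagonalizableQuotientResolution` — the twist-Cartier check of the Galois route may be done in the COMPLETE LOCAL RING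

`…BlowupCartierBaseChangeLocal.isEffectiveCartier_comap_affineBlowup_of_atPrime` (✓ p835768) reduces the Cartier-ness of `π⁻¹L̃` on
`Bl_I(Spec B)` (`L ⊇ 𝔮ᵐ`, `𝔮` maximal — for the Galois route `L = (1 ⊗ σ) I₁`, a twist of the `𝔔'`-primary piece, memo
MEMO-15317-leafhand2-g14 §2/§3) to the local ring `B_𝔮`. This file takes the announced next step ([M–L] in the memo; [S] given the tree):
the check may be done after the FAITHFULLY FLAT base change `B_𝔮 → Ê = (B_𝔮)^` (Mathlib `AdicCompletion.flat_of_isNoetherian`, local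
hence faithfully flat), i.e. in the complete local ring where the twisted germ is compared with the split toric germ.

* `isEffectiveCartier_comap_affineBlowup_of_faithfullyFlat` — `C` faithfully flat over Noetherian `B`, any `I, L`:
  `π'⁻¹(LC)~` Cartier on `Bl_{IC}(Spec C)` ⇒ `π⁻¹L̃` Cartier on `Bl_I(Spec B)`;
* `isEffectiveCartier_comap_affineBlowup_of_adicCompletion` — `R` Noetherian local, `C = R̂`;
* **`isEffectiveCartier_comap_affineBlowup_of_adicCompletion_atPrime`** — `B` Noetherian, `𝔮` maximal, `𝔮ᵐ ⊆ L`: the check on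
  `Bl_{IÊ}(Spec Ê)`, `Ê = (B_𝔮)^`, implies the check on `Bl_I(Spec B)` (THE COMPLETION STEP for the twist obligation of
  `…GaloisChartObligation` / `…GaloisSymmetrizedPieceRegular`).

Honest label: generic scheme plumbing toward ONE leaf stub (no stub, crux or summit closed). No definitions, no named facts, no
sorry. [cite: GortzWedhorn2020, Prop. 13.91 (2)] [cite: StacksProject, Tag 02OO] [cite: Matsumura1987, Thm. 8.14]
-/

noncomputable section

-- single-problem summit: the doubled namespace component is forced
set_option linter.dupNamespace false

open CategoryTheory CategoryTheory.Limits AlgebraicGeometry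
open Literature.AlgebraicGeometry.Resolution
open Summit.ResolutionOfSingularities.ResolutionOfSingularities.Theorems.FRationalResolution

namespace Summit.ResolutionOfSingularities.ResolutionOfSingularities.Theorems.FRationalResolution.BlowupCartierBaseChangeCompletion

/-- **Cartier-ness on `Bl_I(Spec B)` descends along a faithfully flat base change** (`B` Noetherian, any `I, L`).
[cite: GortzWedhorn2020, Prop. 13.91 (2)] [cite: StacksProject, Tag 02OO] -/
theorem isEffectiveCartier_comap_affineBlowup_of_faithfullyFlat {B C : Type} [CommRing B] [CommRing C]
    [IsNoetherianRing B] [Algebra B C] [Module.FaithfullyFlat B C] (I L : Ideal B)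
    (h : IsEffectiveCartier ((affineBlowup.idealSheaf (L.map (algebraMap B C))).comap
      (affineBlowup.π (I.map (algebraMap B C))))) :
    IsEffectiveCartier ((affineBlowup.idealSheaf L).comap (affineBlowup.π I)) := by
  haveI : Flat (Spec.map (CommRingCat.ofHom (algebraMap B C))) := by
    rw [HasRingHomProperty.Spec_iff (P := @Flat), CommRingCat.hom_ofHom]
    exact RingHom.flat_algebraMap_iff.mpr inferInstance
  haveI : Surjective (Spec.map (CommRingCat.ofHom (algebraMap B C))) := by
    refine ⟨fun x => ?_⟩
    obtain ⟨y, hy⟩ := PrimeSpectrum.comap_surjective_of_faithfullyFlat (A := B) (B := C) x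
    exact ⟨y, hy⟩
  exact BlowupCartierBaseChange.isEffectiveCartier_comap_affineBlowup_of_flat_surjective (algebraMap B C) I L h

/-- **Cartier-ness on `Bl_I(Spec R)` descends from the adic completion** (`R` Noetherian local, `R̂ = AdicCompletion 𝔪 R`,
faithfully flat over `R`). [cite: Matsumura1987, Thm. 8.14] [cite: GortzWedhorn2020, Prop. 13.91 (2)] [cite: StacksProject, Tag 02OO] -/
theorem isEffectiveCartier_comap_affineBlowup_of_adicCompletion {R : Type} [CommRing R] [IsNoetherianRing R] [IsLocalRing R]
    (I L : Ideal R)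
    (h : IsEffectiveCartier
      ((affineBlowup.idealSheaf (L.map (algebraMap R (AdicCompletion (IsLocalRing.maximalIdeal R) R)))).comap
        (affineBlowup.π (I.map (algebraMap R (AdicCompletion (IsLocalRing.maximalIdeal R) R)))))) :
    IsEffectiveCartier ((affineBlowup.idealSheaf L).comap (affineBlowup.π I)) := by
  haveI : Module.FaithfullyFlat R (AdicCompletion (IsLocalRing.maximalIdeal R) R) :=
    Module.FaithfullyFlat.of_flat_of_isLocalHom
  exact isEffectiveCartier_comap_affineBlowup_of_faithfullyFlat I L h

/-- **THE COMPLETION STEP for the twist-Cartier obligation.** `B` Noetherian, `𝔮` maximal, `𝔮ᵐ ⊆ L`, `Ê = (B_𝔮)^`: if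
`π̂⁻¹(LÊ)~` is an effective Cartier divisor on `Bl_{IÊ}(Spec Ê)`, then `π⁻¹L̃` is one on `Bl_I(Spec B)`.
[cite: Matsumura1987, Thm. 8.14] [cite: GortzWedhorn2020, Prop. 13.91 (2)] [cite: StacksProject, Tag 02OO; Tag 01WS] -/
theorem isEffectiveCartier_comap_affineBlowup_of_adicCompletion_atPrime {B : Type} [CommRing B] [IsNoetherianRing B]
    (𝔮 : Ideal B) [h𝔮 : 𝔮.IsMaximal] (I L : Ideal B) {m : ℕ} (hL : 𝔮 ^ m ≤ L)
    (h : IsEffectiveCartier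
      ((affineBlowup.idealSheaf ((L.map (algebraMap B (Localization.AtPrime 𝔮))).map
        (algebraMap (Localization.AtPrime 𝔮)
          (AdicCompletion (IsLocalRing.maximalIdeal (Localization.AtPrime 𝔮)) (Localization.AtPrime 𝔮))))).comap
        (affineBlowup.π ((I.map (algebraMap B (Localization.AtPrime 𝔮))).map
          (algebraMap (Localization.AtPrime 𝔮)
            (AdicCompletion (IsLocalRing.maximalIdeal (Localization.AtPrime 𝔮)) (Localization.AtPrime 𝔮))))))) :
    IsEffectiveCartier ((affineBlowup.idealSheaf L).comap (affineBlowup.π I)) := by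
  haveI : IsNoetherianRing (Localization.AtPrime 𝔮) :=
    IsLocalization.isNoetherianRing 𝔮.primeCompl (Localization.AtPrime 𝔮) inferInstance
  exact BlowupCartierBaseChangeLocal.isEffectiveCartier_comap_affineBlowup_of_atPrime 𝔮 I L hL
    (isEffectiveCartier_comap_affineBlowup_of_adicCompletion _ _ h)

end Summit.ResolutionOfSingularities.ResolutionOfSingularities.Theorems.FRationalResolution.BlowupCartierBaseChangeCompletion

end
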